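import Summits.HodgeConjecture.HodgeConjecture.Theorems.K2E5NrdImageOneCovolTransport   -- ★ K2E5-p10 (g2): `ideleBaseChange_mem_fixedAdelicUnits`, `quatNrdImageBase`, `quatNrdImageOneEquiv`; brings ★ #3i∕#3j∕#3k
import Summits.HodgeConjecture.HodgeConjecture.Theorems.K2E5QuatModuleOneDisintegration  -- ★ (27) (K2E5-p03 (g2), p856081): `expUnitsHomeomorph`, `tauExp`, `lintegral_tauExp`, `isHaarMeasure_tauExp`
import Literature.NumberTheory.Automorphic.IdeleNormOneSplitting                        -- ★ `ideleSplitEquiv : 𝕀_K ≃ₜ* 𝕀_K¹ × M`, `locallyCompactSpace_normOneIdeles`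
import Literature.NumberTheory.Automorphic.SiegelConeDyadicExplicit                     -- ★ `posRealIdele_injective`
import HarnessLib

/-!
# K2 ∕ E5 «TamagawaUnitary» — (29-i) `K2E5FixedIdeleDisintegration`: a Haar measure on `𝕀_L^{Gal} ≅ 𝕀_{L⁺}` disintegrated along `𝕀¹_{L⁺} × {ρ(t^{1∕4d})²}`

Cell `hodgecm-mathlib` (Track B «K2-LIT»), engine E5, item h413 = `stmt-HodgeConjecture-24833` (`--supports … --as helper`); dealt BY NAME by
K2E5-plan (g2) (SWEEP #13 (29), 2026-09-04T00:27:49Z) to K2E5-p01 (g2): the `h`-FREE half of the capstone hypothesis (HT) of ★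
`K2E5SUBetaCovolConstOfQuatCovol.suBetaCovolConst_of_quatCovolInvariance` (the twin disintegration `dι = dι¹ ⊗ dt` of the idèle measure of sockets
G3 ∕ G0D along the reduced norm of the central section `θ`).

## The construction (Weil's splitting, no Haar-uniqueness constant)

For a CM field `L` with maximal totally real subfield `L⁺` (`d = [L⁺ : ℚ]`) and ANY Haar measure `ι0` on the norm-one idèles `𝕀¹_{L⁺}`, we CONSTRUCT a Haar
measure `ι` on the `c ⊗ 1`-fixed idèles `fixedAdelicUnits L = bc(𝕀_{L⁺})` (★ #3i Galois descent) such that, for every Borel `g ≥ 0`,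

  `∫⁻ z, g z ∂ι = ∫⁻ t : ℝ, ∫⁻ b, g (bc (b · ρ((e^t)^{1∕4d})²)) ∂ι0`                                   (`exists_fixedIdele_disintegration`)

where `ρ = posRealIdele L⁺` is the diagonal positive-real idèle and `(e^t)^{1∕4d}` is TOKEN FOR TOKEN the parameter of the central section
`θ = quatModuleSection L h` of ★ #3j-b (`Nrd (θ_{e^t}) = bc(ρ((e^t)^{1∕4d}))²`, ★ `quatAdelicNrd_baseScalar`).  Namely
`ι := (Φ ≫ bc)_* (ι0 ⊗ tauExp)` with `tauExp = (t ↦ e^t)_* dt` (★ (27)) and the topological-group isomorphism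

  `Φ : 𝕀¹_{L⁺} × ℝ_{>0} ≃ₜ* 𝕀_{L⁺}`, `(b, u) ↦ b · ρ(q u)`, `q u = (u^{1∕4d})²`                          (`exists_normOne_prod_equiv`)

(★ `ideleSplitEquiv`: `𝕀 = 𝕀¹ × M`, `M = ρ(ℝ_{>0})`; `q` a topological automorphism of `ℝ_{>0}`, `exists_rootSq_equiv`; the open mapping theorem for
σ-compact groups, Mathlib `MonoidHom.isOpenMap_of_sigmaCompact`), composed with the base change `bc : 𝕀_{L⁺} ≃ₜ* fixedAdelicUnits L` (★ #3i
`AdeleRing.ideleBaseChangeHomeomorph`, `fixedAdelicUnits_eq_range_ideleBaseChange`; `exists_baseChange_equiv`).  The integral formula is then Tonelli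
(`lintegral_prod_symm`) and the change of variables `u = e^t` (★ `lintegral_tauExp`); `ι` is a Haar measure as the image of the product Haar measure
under an isomorphism of topological groups.  PROOF LANE: theorems only (every isomorphism is produced as an `∃`).

Sources: Weil, *Basic Number Theory*, Ch. IV §4 Cor. 2 of Thm. 5 (`𝕀 = 𝕀¹ × M`), Ch. VII §5 Lemma 6 (`dt∕t`) [cite: WeilBNT1967, Ch. IV §4 Cor. 2 of Thm. 5];
Cassels–Fröhlich, Ch. XV §4.3 (`d*a = d*b · dt∕t`) [cite: CasselsFrohlichANT1967, Ch. XV §4.3]; Vignéras, LNM 800, Ch. III §2 (`dx^* = dx¹ · dt∕t` along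
the reduced norm) [cite: VignerasLNM800, Ch. III §2].
-/

set_option autoImplicit false

set_option linter.dupNamespace false

noncomputable section

namespace Summit.HodgeConjecture.HodgeConjecture.Cruxes.H413.K2E5FixedIdeleDisintegration

open MeasureTheory Measure NumberField IsDedekindDomain Topology
open Literature.MeasureTheory.Group Literature.NumberTheory.Automorphic
open Literature.NumberTheory.GaloisRepresentations (ideleGroup principalIdeles)
open Summit.HodgeConjecture.HodgeConjecture.Cruxes.H413.K2E5QuatAdelicNrd
open Summit.HodgeConjecture.HodgeConjecture.Cruxes.H413.K2E5QuatAdelicModuleOne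
open Summit.HodgeConjecture.HodgeConjecture.Cruxes.H413.K2E5QuatModuleOneDisintegration
open Summit.HodgeConjecture.HodgeConjecture.Cruxes.H413.K2E5NrdImageOneCovolTransport
open scoped ENNReal NNReal

/-! ## §1 The topological automorphism `u ↦ (u^{1∕4d})²` of `ℝ_{>0}` -/

/-- **`q u = (u^{1∕4d})²` is a topological automorphism of `ℝ_{>0} = ℝ≥0ˣ`** (inverse `u ↦ u^{2d}`; `((u^{1∕4d})²)^{2d} = (u^{1∕4d})^{4d} = u`,
Mathlib `NNReal.rpow_inv_natCast_pow`).  The reparametrisation matching `tauExp` to the reduced norm of the central section `θ`. [folklore] -/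
theorem exists_rootSq_equiv (d : ℕ) (hd : d ≠ 0) :
    ∃ q : ℝ≥0ˣ ≃ₜ* ℝ≥0ˣ, ∀ u : ℝ≥0ˣ, q u = Units.map (NNReal.rpowMonoidHom (((4 * d : ℕ) : ℝ)⁻¹)) u ^ 2 := by
  have h4d : 4 * d ≠ 0 := Nat.mul_ne_zero (by norm_num) hd
  let f : ℝ≥0ˣ →* ℝ≥0ˣ := (powMonoidHom 2).comp (Units.map (NNReal.rpowMonoidHom (((4 * d : ℕ) : ℝ)⁻¹)))
  let g : ℝ≥0ˣ →* ℝ≥0ˣ := powMonoidHom (2 * d)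
  have hf : ∀ u : ℝ≥0ˣ, ((f u : ℝ≥0ˣ) : ℝ≥0) = ((u : ℝ≥0) ^ (((4 * d : ℕ) : ℝ)⁻¹)) ^ 2 := fun u => rfl
  have hg : ∀ u : ℝ≥0ˣ, ((g u : ℝ≥0ˣ) : ℝ≥0) = (u : ℝ≥0) ^ (2 * d) := fun u => rfl
  have hgf : ∀ u, g (f u) = u := by
    intro u
    apply Units.ext
    rw [hg, hf, ← pow_mul, show 2 * (2 * d) = 4 * d by ring]
    exact NNReal.rpow_inv_natCast_pow _ h4d
  have hginj : Function.Injective g := by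
    intro u v huv
    have h := congrArg (fun w : ℝ≥0ˣ => (w : ℝ≥0)) huv
    simp only [hg] at h
    exact Units.ext ((pow_left_inj₀ zero_le zero_le (Nat.mul_ne_zero (by norm_num) hd)).1 h)
  have hfg : ∀ u, f (g u) = u := fun u => hginj (hgf (g u))
  have hfc : Continuous f := by
    refine (continuous_pow 2).comp ?_
    refine Units.continuous_iff.2 ⟨?_, ?_⟩
    · exact (NNReal.continuous_rpow_const (inv_nonneg.2 (Nat.cast_nonneg _))).comp Units.continuous_val
    · have : (fun u : ℝ≥0ˣ => ((↑(Units.map (NNReal.rpowMonoidHom (((4 * d : ℕ) : ℝ)⁻¹)) u)⁻¹ : ℝ≥0ˣ) : ℝ≥0)) =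
          fun u : ℝ≥0ˣ => ((u⁻¹ : ℝ≥0ˣ) : ℝ≥0) ^ (((4 * d : ℕ) : ℝ)⁻¹) := by
        funext u
        rw [← map_inv]
        rfl
      rw [this]
      exact (NNReal.continuous_rpow_const (inv_nonneg.2 (Nat.cast_nonneg _))).comp Units.continuous_coe_inv
  have hgc : Continuous g := continuous_pow (2 * d)
  refine ⟨{ MonoidHom.toMulEquiv f g (MonoidHom.ext hgf) (MonoidHom.ext hfg) with
    continuous_toFun := hfc, continuous_invFun := hgc }, fun u => rfl⟩

/-! ## §2 Weil's splitting reparametrised: `𝕀¹_K × ℝ_{>0} ≃ₜ* 𝕀_K`, `(b, u) ↦ b · ρ(q u)` -/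

section Split

variable (K : Type) [Field K] [NumberField K]

/-- **`Φ : 𝕀¹_K × ℝ_{>0} ≃ₜ* 𝕀_K`, `(b, u) ↦ b · ρ(q u)`** for any topological automorphism `q` of `ℝ_{>0}`: Weil's direct-product splitting `𝕀_K = 𝕀¹_K × M`
(★ `ideleSplitEquiv`) with the split component `M = ρ(ℝ_{>0})` parametrised by `ρ ∘ q` (`ρ = posRealIdele K` injective ★ `posRealIdele_injective`,
continuous ★ `continuous_posRealIdele`); a continuous bijective homomorphism from the σ-compact group `𝕀¹_K × ℝ_{>0}` onto the locally compact group
`𝕀_K` is open (Mathlib `MonoidHom.isOpenMap_of_sigmaCompact`). [cite: WeilBNT1967, Ch. IV §4 Cor. 2 of Thm. 5] -/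
theorem exists_normOne_prod_equiv (q : ℝ≥0ˣ ≃ₜ* ℝ≥0ˣ) :
    ∃ Φ : (↥(normOneIdeles K) × ℝ≥0ˣ) ≃ₜ* ideleGroup K,
      ∀ b : ↥(normOneIdeles K), ∀ u : ℝ≥0ˣ, Φ (b, u) = (b : ideleGroup K) * posRealIdele K (q u) := by
  haveI := locallyCompactSpace_ideleGroup K
  haveI := secondCountableTopology_ideleGroup K
  haveI := t2Space_ideleGroup K
  haveI := locallyCompactSpace_normOneIdeles K
  haveI : SecondCountableTopology ↥(normOneIdeles K) := TopologicalSpace.Subtype.secondCountableTopology _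
  haveI : LocallyCompactSpace ℝ≥0ˣ := K2E5QuatUnitsUnimodular.locallyCompactSpace_nnrealUnits
  haveI : SecondCountableTopology ℝ≥0ˣ := K2E5QuatUnitsUnimodular.secondCountableTopology_nnrealUnits
  let F : (↥(normOneIdeles K) × ℝ≥0ˣ) →* ideleGroup K :=
    ((normOneIdeles K).subtype.coprod ((posRealIdele K).comp q.toMonoidHom))
  have hF : ∀ b u, F (b, u) = (b : ideleGroup K) * posRealIdele K (q u) := fun b u => rfl
  have hFc : Continuous F := by
    show Continuous fun p : ↥(normOneIdeles K) × ℝ≥0ˣ => F p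
    have : (fun p : ↥(normOneIdeles K) × ℝ≥0ˣ => F p) = fun p => (p.1 : ideleGroup K) * posRealIdele K (q p.2) := funext fun p => hF p.1 p.2
    rw [this]
    exact (continuous_subtype_val.comp continuous_fst).mul ((continuous_posRealIdele K).comp (q.continuous.comp continuous_snd))
  -- bijectivity through `ideleSplitEquiv`: `F = ideleSplitEquiv⁻¹ ∘ (id × (ρ ∘ q))`
  have hFe : ∀ p : ↥(normOneIdeles K) × ℝ≥0ˣ, F p = (ideleSplitEquiv K).symm (p.1, ⟨posRealIdele K (q p.2), ⟨q p.2, rfl⟩⟩) := by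
    rintro ⟨b, u⟩
    rw [hF, ideleSplitEquiv_symm_apply]
  have hFinj : Function.Injective F := by
    intro p p' h
    rw [hFe, hFe] at h
    have h' := (ideleSplitEquiv K).symm.injective h
    have h1 : p.1 = p'.1 := congrArg (fun z : ↥(normOneIdeles K) × ↥(posRealIdeles K) => z.1) h'
    have h2 : posRealIdele K (q p.2) = posRealIdele K (q p'.2) :=
      congrArg (fun z : ↥(normOneIdeles K) × ↥(posRealIdeles K) => ((z.2 : ↥(posRealIdeles K)) : ideleGroup K)) h'
    exact Prod.ext h1 (q.injective (posRealIdele_injective K h2))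
  have hFsurj : Function.Surjective F := by
    intro x
    obtain ⟨r, hr⟩ : ∃ r : ℝ≥0ˣ, posRealIdele K r = (((ideleSplitEquiv K x).2 : ↥(posRealIdeles K)) : ideleGroup K) := ((ideleSplitEquiv K x).2).2
    refine ⟨((ideleSplitEquiv K x).1, q.symm r), ?_⟩
    rw [hFe]
    conv_rhs => rw [← (ideleSplitEquiv K).symm_apply_apply x]
    congr 1
    refine Prod.ext rfl (Subtype.ext ?_)
    show posRealIdele K (q (q.symm r)) = _
    rw [ContinuousMulEquiv.apply_symm_apply]
    exact hr
  have hFo : IsOpenMap F := MonoidHom.isOpenMap_of_sigmaCompact F hFsurj hFc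
  refine ⟨{ (Equiv.ofBijective F ⟨hFinj, hFsurj⟩).toHomeomorphOfContinuousOpen hFc hFo with
    map_mul' := fun p p' => map_mul F p p' }, fun b u => rfl⟩

end Split

/-! ## §3 The base change `𝕀_{L⁺} ≃ₜ* fixedAdelicUnits L` -/

section BaseChange

variable (L : Type) [Field L] [NumberField L] [IsCMField L]

/-- **`bc : 𝕀_{L⁺} ≃ₜ* 𝕀_L^{⟨c ⊗ 1⟩}`** as an isomorphism of topological groups (★ #3i: `AdeleRing.ideleBaseChangeHomeomorph` onto the closed range, and Galois
descent `fixedAdelicUnits L = range bc`, ★ `fixedAdelicUnits_eq_range_ideleBaseChange`). [cite: CasselsFrohlichANT1967, Ch. II §14] -/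
theorem exists_baseChange_equiv :
    ∃ e : ideleGroup ↥(maximalRealSubfield L) ≃ₜ* ↥(fixedAdelicUnits L),
      ∀ x, ((e x : ↥(fixedAdelicUnits L)) : ideleGroup L) = AdeleRing.ideleBaseChange (↥(maximalRealSubfield L)) L x := by
  let h := AdeleRing.ideleBaseChangeHomeomorph (↥(maximalRealSubfield L)) L
  let c : ↥((AdeleRing.ideleBaseChange (↥(maximalRealSubfield L)) L).range) ≃ₜ ↥(fixedAdelicUnits L) :=
    Homeomorph.setCongr (congrArg (fun H : Subgroup (ideleGroup L) => (H : Set (ideleGroup L))) (fixedAdelicUnits_eq_range_ideleBaseChange L).symm)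
  have hc : ∀ y, ((c y : ↥(fixedAdelicUnits L)) : ideleGroup L) = (y : ideleGroup L) := fun y => rfl
  refine ⟨{ h.trans c with
    map_mul' := fun x y => ?_ }, fun x => rfl⟩
  apply Subtype.ext
  show (((h.trans c) (x * y) : ↥(fixedAdelicUnits L)) : ideleGroup L) = ((h.trans c x : ↥(fixedAdelicUnits L)) : ideleGroup L) * ((h.trans c y : ↥(fixedAdelicUnits L)) : ideleGroup L)
  simp only [Homeomorph.trans_apply, hc, h, AdeleRing.coe_ideleBaseChangeHomeomorph_apply, map_mul]

end BaseChange

/-! ## §4 The disintegrated Haar measure on `fixedAdelicUnits L` -/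

section Main

variable (L : Type) [Field L] [NumberField L] [IsCMField L]
variable [MeasurableSpace (AdeleRing (𝓞 L) L)ˣ] [BorelSpace (AdeleRing (𝓞 L) L)ˣ]
variable [MeasurableSpace (ideleGroup ↥(maximalRealSubfield L))] [BorelSpace (ideleGroup ↥(maximalRealSubfield L))]

/-- **A Haar measure on `𝕀_L^{Gal} ≅ 𝕀_{L⁺}` disintegrated as `dι = dι0 ⊗ dt` along `𝕀¹_{L⁺} × {ρ((e^t)^{1∕4d})²}`.**  For every Haar measure `ι0` on the norm-one
idèles `𝕀¹_{L⁺}` there is a Haar measure `ι` on `fixedAdelicUnits L` with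

  `∫⁻ z, g z ∂ι = ∫⁻ t : ℝ, ∫⁻ b, g ⟨bc (b · ρ((e^t)^{1∕4d})²), _⟩ ∂ι0`     for every Borel `g ≥ 0`

(`ρ = posRealIdele L⁺`, `d = [L⁺ : ℚ]`; `ρ((e^t)^{1∕4d})²` is the idèle of `L⁺` under the reduced norm of the central section `θ_{e^t}` of ★ #3j-b).
Construction: `ι := (Φ ≫ bc)_* (ι0 ⊗ tauExp)` (§2, §3, ★ (27) `tauExp`); Haar as the image of a product Haar measure under an isomorphism of topological
groups; the formula by Tonelli and `u = e^t` (★ `lintegral_tauExp`). [cite: WeilBNT1967, Ch. IV §4 Cor. 2 of Thm. 5] [cite: CasselsFrohlichANT1967, Ch. XV §4.3]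
[cite: VignerasLNM800, Ch. III §2] -/
theorem exists_fixedIdele_disintegration (ι0 : Measure ↥(normOneIdeles ↥(maximalRealSubfield L))) [ι0.IsHaarMeasure] :
    ∃ (ι : Measure ↥(fixedAdelicUnits L)) (_ : ι.IsHaarMeasure),
      ∀ g : ↥(fixedAdelicUnits L) → ℝ≥0∞, Measurable g →
        ∫⁻ z, g z ∂ι = ∫⁻ t : ℝ, ∫⁻ b : ↥(normOneIdeles ↥(maximalRealSubfield L)),
          g ⟨AdeleRing.ideleBaseChange (↥(maximalRealSubfield L)) L
              ((b : ideleGroup ↥(maximalRealSubfield L)) * posRealIdele ↥(maximalRealSubfield L)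
                (Units.map (NNReal.rpowMonoidHom (((4 * Module.finrank ℚ ↥(maximalRealSubfield L) : ℕ) : ℝ)⁻¹))
                  (Units.mk0 (Real.toNNReal (Real.exp t)) (Real.toNNReal_pos.2 (Real.exp_pos t)).ne')) ^ 2),
            ideleBaseChange_mem_fixedAdelicUnits L _⟩ ∂ι0 := by
  -- instances
  haveI := locallyCompactSpace_ideleGroup ↥(maximalRealSubfield L)
  haveI := secondCountableTopology_ideleGroup ↥(maximalRealSubfield L)
  haveI := t2Space_ideleGroup ↥(maximalRealSubfield L)
  haveI := locallyCompactSpace_normOneIdeles ↥(maximalRealSubfield L)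
  haveI : BorelSpace ↥(normOneIdeles ↥(maximalRealSubfield L)) := Subtype.borelSpace _
  haveI : SecondCountableTopology ↥(normOneIdeles ↥(maximalRealSubfield L)) := TopologicalSpace.Subtype.secondCountableTopology _
  haveI : BorelSpace ↥(fixedAdelicUnits L) := Subtype.borelSpace _
  letI : MeasurableSpace ℝ≥0ˣ := borel _
  haveI : BorelSpace ℝ≥0ˣ := ⟨rfl⟩
  haveI : LocallyCompactSpace ℝ≥0ˣ := K2E5QuatUnitsUnimodular.locallyCompactSpace_nnrealUnits
  haveI : SecondCountableTopology ℝ≥0ˣ := K2E5QuatUnitsUnimodular.secondCountableTopology_nnrealUnits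
  haveI : BorelSpace (↥(normOneIdeles ↥(maximalRealSubfield L)) × ℝ≥0ˣ) := Prod.borelSpace
  haveI := isHaarMeasure_tauExp
  -- the isomorphisms
  obtain ⟨q, hq⟩ := exists_rootSq_equiv (Module.finrank ℚ ↥(maximalRealSubfield L)) Module.finrank_pos.ne'
  obtain ⟨Φ, hΦ⟩ := exists_normOne_prod_equiv (↥(maximalRealSubfield L)) q
  obtain ⟨e, he⟩ := exists_baseChange_equiv L
  let Ψ : (↥(normOneIdeles ↥(maximalRealSubfield L)) × ℝ≥0ˣ) ≃ₜ* ↥(fixedAdelicUnits L) := Φ.trans e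
  -- the measure
  let π : Measure (↥(normOneIdeles ↥(maximalRealSubfield L)) × ℝ≥0ˣ) := ι0.prod tauExp
  haveI hπ : π.IsHaarMeasure := by infer_instance
  refine ⟨Measure.map Ψ π, Ψ.toMulEquiv.isHaarMeasure_map π Ψ.continuous Ψ.symm.continuous, fun g hg => ?_⟩
  -- transport to the product and Tonelli
  have hgΨ : Measurable fun p : ↥(normOneIdeles ↥(maximalRealSubfield L)) × ℝ≥0ˣ => g (Ψ p) := hg.comp Ψ.continuous.measurable
  have h1 : ∫⁻ z, g z ∂(Measure.map Ψ π) = ∫⁻ p, g (Ψ p) ∂π := by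
    rw [show (Ψ : _ → ↥(fixedAdelicUnits L)) = Ψ.toHomeomorph.toMeasurableEquiv from rfl, lintegral_map_equiv]
  rw [h1, lintegral_prod_symm _ hgΨ.aemeasurable]
  -- the `ℝ_{>0}`-integral is `dt` along `u = e^t`
  have hinner : Measurable fun u : ℝ≥0ˣ => ∫⁻ b, g (Ψ (b, u)) ∂ι0 := hgΨ.lintegral_prod_left'
  rw [lintegral_tauExp hinner]
  refine lintegral_congr fun t => lintegral_congr fun b => ?_
  congr 1
  apply Subtype.ext
  show ((e (Φ (b, _)) : ↥(fixedAdelicUnits L)) : ideleGroup L) = _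
  rw [he, hΦ, hq, map_pow]

end Main

end Summit.HodgeConjecture.HodgeConjecture.Cruxes.H413.K2E5FixedIdeleDisintegration

end
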